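import Summits.ABC.StewartYu.PadicG3LevelStepH
import HarnessLib

/-!
# Cell abc-stewartyu, crux `Y07Odd` (stmt-ABC-19658), line `gen3-slab-odd`: the three steps of the odd-`p` frame with STATE-INDEPENDENT record
# hypotheses (uniform over the unknown set `U ⊇ B` and the exponent box) — the form the record's schedule supplies

`Summits/ABC/StewartYu/PadicG3StepPacks.lean` — cell `abc-stewartyu` (seat p2-g4, F-odd lead).  Definitions (`KStepHypU`, `KStepOddHypU`, `HalfStepHypU` —
`Prop`-valued packages of the record's data and inequalities for one step, quantified uniformly over `i ∈ U` and over all exponent vectors in the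
box, hence independent of the evolving family) and the three step theorems on `LvInvI` consuming them (`kstep_of_hypU`, `kstep_odd_of_hypU`,
`halfStep_of_hypU`).  No named fact; no parameters.

WHAT THIS IS NOT: the schedule induction (`PadicG3Schedule`) and the assembly (`PadicG3FrameOdd`); no crux moves.

References: Yu. V. Nesterenko, LNM 1819 (2003) Prop. 4.1; K. Yu, Acta Math. 211 (2013) §5.
-/

noncomputable section

open NormedSpace Finset Polynomial
open Literature.NumberTheory.Transcendental
open Literature.NumberTheory.Transcendental.PadicCW77 (condExp)
open Literature.NumberTheory.Transcendental.CW77.Setup (Tau tauNorm)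
open scoped Nat

namespace Summit.ABC.StewartYu

namespace G3Setup

variable {p : ℕ} [Fact p.Prime] (S : G3Setup p) {ι : Type*}

/-! ### The packages -/

/-- **Record package of one k-step (symmetric nodes `N → N′`, orders `T → T′`)**, uniform over `i ∈ U` and the box `L`.
[cite: Nesterenko2003, §4.2; shape only] -/
def KStepHypU (R : ι → ℚ[X]) (U : Finset ι) (L : Fin S.n → ℕ) (P : ℤ) (m N N' T T' : ℕ) : Prop :=
  ∃ (t : ℕ) (Bw : ℝ) (den₀ : ℤ → Tau S.n → ℕ) (M₀ : ℤ → Tau S.n → ℤ) (Xb : ℤ) (K : ℤ → Tau S.n → ℝ),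
    1 ≤ t ∧ T' + t ≤ T ∧ 0 ≤ Bw ∧
    (∀ i ∈ U, ∀ t₀ k, ‖(hw (p := p) R i t₀).coeff k‖ * ((p : ℝ) ^ m * Real.sqrt p) ^ k ≤ Bw) ∧
    (∀ x τ, 1 ≤ den₀ x τ) ∧
    (∀ (x : ℤ) (τ : Tau S.n), ∀ i ∈ U, ∃ z₀ : ℤ, (den₀ x τ : ℚ) * (hasseDeriv τ.1 (R i)).eval (x : ℚ) = z₀ ∧ |z₀| ≤ M₀ x τ) ∧
    (∀ w : Fin S.n → ℤ, (∀ j, |w j| ≤ (L j : ℤ)) → ∀ k, |S.𝔛 w k| ≤ Xb) ∧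
    (∀ x τ, 0 < K x τ) ∧
    (∀ (x : ℤ) (τ : Tau S.n), (U.card : ℝ) * P * (M₀ x τ * (Xb : ℝ) ^ (∑ k, τ.2 k) *
      ((MonomialDen.monDen S.α (S.boxExpG L x) : ℝ)) ^ 2) ≤ K x τ) ∧
    (∀ x₁ : ℤ, |x₁| ≤ (N' : ℤ) → ∀ τ : Tau S.n, tauNorm τ + t ≤ T →
      max (Bw * ‖S.Λ / (S.b S.j₀ : ℚ_[p])‖ * (p : ℝ) ^ ((t - 1) / 2) * (p : ℝ) ^ condExp p (2 * N + 1) t)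
        (Bw / ((p : ℝ) ^ m * Real.sqrt p) ^ ((2 * N + 1) * t)) < 1 / K x₁ τ)

/-- **Record package of the first k-step of a level (odd nodes `|x| ≤ 2N−1 → |x| ≤ N′`)**. [cite: Nesterenko2003, §4.2; shape only] -/
def KStepOddHypU (R : ι → ℚ[X]) (U : Finset ι) (L : Fin S.n → ℕ) (P : ℤ) (m N N' T T' : ℕ) : Prop :=
  ∃ (t : ℕ) (Bw : ℝ) (den₀ : ℤ → Tau S.n → ℕ) (M₀ : ℤ → Tau S.n → ℤ) (Xb : ℤ) (K : ℤ → Tau S.n → ℝ),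
    1 ≤ t ∧ T' + t ≤ T ∧ 0 ≤ Bw ∧
    (∀ i ∈ U, ∀ t₀ k, ‖(hw (p := p) R i t₀).coeff k‖ * ((p : ℝ) ^ m * Real.sqrt p) ^ k ≤ Bw) ∧
    (∀ x τ, 1 ≤ den₀ x τ) ∧
    (∀ (x : ℤ) (τ : Tau S.n), ∀ i ∈ U, ∃ z₀ : ℤ, (den₀ x τ : ℚ) * (hasseDeriv τ.1 (R i)).eval (x : ℚ) = z₀ ∧ |z₀| ≤ M₀ x τ) ∧
    (∀ w : Fin S.n → ℤ, (∀ j, |w j| ≤ (L j : ℤ)) → ∀ k, |S.𝔛 w k| ≤ Xb) ∧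
    (∀ x τ, 0 < K x τ) ∧
    (∀ (x : ℤ) (τ : Tau S.n), (U.card : ℝ) * P * (M₀ x τ * (Xb : ℝ) ^ (∑ k, τ.2 k) *
      ((MonomialDen.monDen S.α (S.boxExpG L x) : ℝ)) ^ 2) ≤ K x τ) ∧
    (∀ x₁ : ℤ, |x₁| ≤ (N' : ℤ) → ∀ τ : Tau S.n, tauNorm τ + t ≤ T →
      max (Bw * ‖S.Λ / (S.b S.j₀ : ℚ_[p])‖ * (p : ℝ) ^ ((t - 1) / 2) * (p : ℝ) ^ condExp p (2 * N) t)
        (Bw / ((p : ℝ) ^ m * Real.sqrt p) ^ ((2 * N) * t)) < 1 / K x₁ τ)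

/-- The summand of the PM class sums for an arbitrary exponent vector `w` (uniform form of `LvInvI.hterm`). [folklore] -/
def htermW (R : ι → ℚ[X]) (L : Fin S.n → ℕ) (s₁ : ℤ) (τ : Tau S.n) (i : ι) (w : Fin S.n → ℤ) : ℚ :=
  ((hasseDeriv τ.1 (R i)).eval ((s₁ : ℚ) / 2) * ∏ k, S.zγ w k ^ τ.2 k) * HalfMono.qEhG S.α (S.rootExp L w s₁)

/-- **Record package of the Kummer half-step at a level** (`|x| ≤ N` → odd `|x| ≤ 2N₁−1`, orders `T → T′`, next polynomials `R′`),
uniform over `i ∈ U` and the box. [cite: Nesterenko2003, §4.3; shape only] -/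
def HalfStepHypU (R R' : ι → ℚ[X]) (U : Finset ι) (L : Fin S.n → ℕ) (P : ℤ) (m N N₁ T T' : ℕ) : Prop :=
  ∃ (t : ℕ) (Bw : ℝ) (c : ℕ → ℚ) (D : ℤ → Tau S.n → ℕ) (Mh : ℤ → Tau S.n → ℝ),
    1 ≤ t ∧ T' + t ≤ T ∧ 0 ≤ Bw ∧
    (∀ i ∈ U, ∀ t₀ k, ‖(hw (p := p) R i t₀).coeff k‖ * ((p : ℝ) ^ m * Real.sqrt p) ^ k ≤ Bw) ∧
    (∀ t₀, c t₀ ≠ 0) ∧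
    (∀ i ∈ U, ∀ (t₀ : ℕ) (s₁ : ℤ), (hasseDeriv t₀ (R i)).eval ((s₁ : ℚ) / 2) = c t₀ * (hasseDeriv t₀ (R' i)).eval (s₁ : ℚ)) ∧
    (∀ s₁ τ, 1 ≤ D s₁ τ) ∧ (∀ s₁ τ, 0 ≤ Mh s₁ τ) ∧
    (∀ (s₁ : ℤ) (τ : Tau S.n), ∀ i ∈ U, ∀ w : Fin S.n → ℤ, (∀ j, |w j| ≤ (L j : ℤ)) →
      ∃ z : ℤ, (D s₁ τ : ℚ) * S.htermW R L s₁ τ i w = z) ∧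
    (∀ (s₁ : ℤ) (τ : Tau S.n), ∀ i ∈ U, ∀ w : Fin S.n → ℤ, (∀ j, |w j| ≤ (L j : ℤ)) →
      |(S.htermW R L s₁ τ i w : ℝ)| ≤ Mh s₁ τ) ∧
    (∀ s₁ : ℤ, Odd s₁ → |s₁| ≤ (2 * N₁ - 1 : ℤ) → ∀ τ : Tau S.n, tauNorm τ + t ≤ T →
      max (Bw * ‖S.Λ / (S.b S.j₀ : ℚ_[p])‖ * (p : ℝ) ^ ((t - 1) / 2) * (p : ℝ) ^ condExp p (2 * N + 1) t)
        (Bw / ((p : ℝ) ^ m * Real.sqrt p) ^ ((2 * N + 1) * t)) <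
      (D s₁ τ : ℝ) / (4 * (D s₁ τ : ℝ) ^ 2 * (1 + (U.card : ℝ) * P * Mh s₁ τ) * CW77.heightProd S.α ^ 3) ^ (2 ^ (S.n + 1)))

/-! ### The steps consuming the packages -/

namespace LvInvI

variable {S} {R R' : ι → ℚ[X]} {U B : Finset ι} {v : ι → Fin S.n → ℤ} {sgn pv : ι → ℤ} {lo : Fin S.n → ℤ} {L : Fin S.n → ℕ}
  {P : ℤ} {m N N' N₁ T T' : ℕ}

/-- `#B · P ≤ #U · P` for `B ⊆ U`, `0 ≤ P`. [folklore] -/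
theorem card_mul_le_of_subset (hBU : B ⊆ U) (hP : (0 : ℝ) ≤ P) : (B.card : ℝ) * P ≤ (U.card : ℝ) * P :=
  mul_le_mul_of_nonneg_right (by exact_mod_cast card_le_card hBU) hP

/-- **k-step from the uniform package.** [cite: Nesterenko2003, §4.2] -/
theorem kstep_of_hypU (hBU : B ⊆ U) (h : S.LvInvI R B v sgn pv lo L P m {x : ℤ | |x| ≤ (N : ℤ)} T)
    (hΛ : ‖S.Λ / (S.b S.j₀ : ℚ_[p])‖ ≤ (p : ℝ)⁻¹) (H : S.KStepHypU R U L P m N N' T T') :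
    S.LvInvI R B v sgn pv lo L P m {x : ℤ | |x| ≤ (N' : ℤ)} T' := by
  obtain ⟨t, Bw, den₀, M₀, Xb, K, ht, hT, hBw0, hBw, hden₀, hR, hXb, hK0, hK, hfinal⟩ := H
  obtain ⟨i₀, hi₀B, hi₀⟩ := h.nonzero
  have hP0 : (0 : ℝ) ≤ P := by
    have := h.bound i₀ hi₀B; exact_mod_cast (abs_nonneg _).trans this
  refine h.kstep ht hT hBw0 (fun i hi => hBw i (hBU hi)) hΛ den₀ hden₀ M₀ (fun x τ i hi => hR x τ i (hBU hi))
    (fun i hi k => hXb (v i) (h.abs_le i hi) k) K hK0 (fun x τ => le_trans ?_ (hK x τ)) hfinal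
  have hM0 : (0 : ℝ) ≤ M₀ x τ := by
    obtain ⟨z₀, _, hz₀⟩ := hR x τ i₀ (hBU hi₀B); exact_mod_cast (abs_nonneg _).trans hz₀
  have hXb0 : (0 : ℝ) ≤ Xb := by
    have := hXb 0 (fun j => by simp) S.j₀; exact_mod_cast (abs_nonneg _).trans this
  have hfac : 0 ≤ (M₀ x τ : ℝ) * (Xb : ℝ) ^ (∑ k, τ.2 k) * ((MonomialDen.monDen S.α (S.boxExpG L x) : ℝ)) ^ 2 := by positivity
  calc (B.card : ℝ) * P * ((M₀ x τ : ℝ) * (Xb : ℝ) ^ (∑ k, τ.2 k) * ((MonomialDen.monDen S.α (S.boxExpG L x) : ℝ)) ^ 2)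
      ≤ (U.card : ℝ) * P * ((M₀ x τ : ℝ) * (Xb : ℝ) ^ (∑ k, τ.2 k) * ((MonomialDen.monDen S.α (S.boxExpG L x) : ℝ)) ^ 2) :=
        mul_le_mul_of_nonneg_right (card_mul_le_of_subset hBU hP0) hfac

/-- **First k-step of a level from the uniform package.** [cite: Nesterenko2003, §4.2] -/
theorem kstep_odd_of_hypU (hBU : B ⊆ U) (h : S.LvInvI R B v sgn pv lo L P m {x : ℤ | Odd x ∧ |x| ≤ (2 * N - 1 : ℤ)} T)
    (hΛ : ‖S.Λ / (S.b S.j₀ : ℚ_[p])‖ ≤ (p : ℝ)⁻¹) (H : S.KStepOddHypU R U L P m N N' T T') :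
    S.LvInvI R B v sgn pv lo L P m {x : ℤ | |x| ≤ (N' : ℤ)} T' := by
  obtain ⟨t, Bw, den₀, M₀, Xb, K, ht, hT, hBw0, hBw, hden₀, hR, hXb, hK0, hK, hfinal⟩ := H
  obtain ⟨i₀, hi₀B, hi₀⟩ := h.nonzero
  have hP0 : (0 : ℝ) ≤ P := by
    have := h.bound i₀ hi₀B; exact_mod_cast (abs_nonneg _).trans this
  refine h.kstep_odd ht hT hBw0 (fun i hi => hBw i (hBU hi)) hΛ den₀ hden₀ M₀ (fun x τ i hi => hR x τ i (hBU hi))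
    (fun i hi k => hXb (v i) (h.abs_le i hi) k) K hK0 (fun x τ => le_trans ?_ (hK x τ)) hfinal
  have hM0 : (0 : ℝ) ≤ M₀ x τ := by
    obtain ⟨z₀, _, hz₀⟩ := hR x τ i₀ (hBU hi₀B); exact_mod_cast (abs_nonneg _).trans hz₀
  have hXb0 : (0 : ℝ) ≤ Xb := by
    have := hXb 0 (fun j => by simp) S.j₀; exact_mod_cast (abs_nonneg _).trans this
  have hfac : 0 ≤ (M₀ x τ : ℝ) * (Xb : ℝ) ^ (∑ k, τ.2 k) * ((MonomialDen.monDen S.α (S.boxExpG L x) : ℝ)) ^ 2 := by positivity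
  exact mul_le_mul_of_nonneg_right (card_mul_le_of_subset hBU hP0) hfac

/-- **Kummer half-step from the uniform package** (new unknown set `pivotClass ⊆ B ⊆ U`). [cite: Nesterenko2003, §4.3] -/
theorem halfStep_of_hypU [DecidableEq ι] (hBU : B ⊆ U) (h : S.LvInvI R B v sgn pv lo L P m {x : ℤ | |x| ≤ (N : ℤ)} T)
    (hΛ : ‖S.Λ / (S.b S.j₀ : ℚ_[p])‖ ≤ (p : ℝ)⁻¹) (hΛm : ‖S.Λ / (S.b S.j₀ : ℚ_[p])‖ ≤ (p : ℝ)⁻¹ ^ (m + 1))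
    {ζ : ℚ_[p]} (hζ : IsPrimitiveRoot ζ (p - 1)) (hζM : ζ ^ ((p - 1) / 2) = -1) (hζ1 : ‖ζ‖ = 1) (r : Fin S.n → ℕ)
    (hη : ∀ j, S.η j = ζ ^ r j)
    (hind : ∀ T₁ : Finset (Fin S.n), T₁.Nonempty → ¬ IsSquare (∏ j ∈ T₁, S.α j) ∧ ¬ IsSquare (-∏ j ∈ T₁, S.α j))
    (H : S.HalfStepHypU R R' U L P m N N₁ T T') :
    ∃ i₀ ∈ B, pv i₀ ≠ 0 ∧
      S.LvInvI R' (S.pivotClass v sgn B i₀) (S.halfDiff v i₀) (S.sgnOf (S.halfDiff v i₀)) pv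
        (fun j => -((v i₀ j - lo j) / 2)) (fun j => L j / 2) P m {x : ℤ | Odd x ∧ |x| ≤ (2 * N₁ - 1 : ℤ)} T' := by
  obtain ⟨t, Bw, c, D, Mh, ht, hT, hBw0, hBw, hc, hRR', hD, hMh, hint, hsize, hineq⟩ := H
  obtain ⟨i₀, hi₀B, hi₀⟩ := h.nonzero
  have hP0 : (0 : ℝ) ≤ P := by
    have := h.bound i₀ hi₀B; exact_mod_cast (abs_nonneg _).trans this
  -- the total size of the class-sum terms
  have hMb1 : ∀ s₁ τ, (1 : ℝ) ≤ 1 + (U.card : ℝ) * P * Mh s₁ τ := fun s₁ τ => by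
    have : 0 ≤ (U.card : ℝ) * P * Mh s₁ τ := by have := hMh s₁ τ; positivity
    linarith
  refine h.halfStep hΛ hΛm hζ hζM hζ1 r hη hind ht hT hBw0 (fun i hi => hBw i (hBU hi)) c hc (fun i hi => hRR' i (hBU hi)) D hD
    (fun s₁ τ => 1 + (U.card : ℝ) * P * Mh s₁ τ) hMb1 (fun s₁ τ i hi => hint s₁ τ i (hBU hi) (v i) (h.abs_le i hi)) ?_ hineq
  intro s₁ τ
  have hterm_le : ∀ i ∈ B, |((pv i : ℚ) * hterm S R v L s₁ τ i : ℝ)| ≤ P * Mh s₁ τ := by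
    intro i hi
    push_cast
    rw [abs_mul]
    have h1 : |((pv i : ℚ) : ℝ)| ≤ P := by
      rw [Rat.cast_intCast, ← Int.cast_abs]; exact_mod_cast h.bound i hi
    have h2 : |(hterm S R v L s₁ τ i : ℝ)| ≤ Mh s₁ τ := hsize s₁ τ i (hBU hi) (v i) (h.abs_le i hi)
    exact mul_le_mul h1 h2 (abs_nonneg _) hP0
  calc ∑ i ∈ B, |((pv i : ℚ) * hterm S R v L s₁ τ i : ℝ)| ≤ ∑ i ∈ B, (P : ℝ) * Mh s₁ τ := sum_le_sum hterm_le
    _ = (B.card : ℝ) * P * Mh s₁ τ := by rw [sum_const, nsmul_eq_mul]; ring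
    _ ≤ (U.card : ℝ) * P * Mh s₁ τ := mul_le_mul_of_nonneg_right (card_mul_le_of_subset hBU hP0) (hMh s₁ τ)
    _ ≤ 1 + (U.card : ℝ) * P * Mh s₁ τ := by linarith

end LvInvI

end G3Setup

end Summit.ABC.StewartYu

end
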